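import Mathlib.Logic.Equiv.Fin.Basic
import Literature.Computability.Complexity.SymmetricCircuit
import Literature.Computability.Complexity.CircuitPlug

/-!
# Symmetric circuits: induced automorphisms are closed under plugging

Companion of `SymmetricCircuit.lean` and `CircuitPlug.lean` (Anderson–Dawar, *On symmetric circuits
and fixed-point logics*, Theory Comput. Syst. 60 (2017), §2: symmetric circuits are closed under the
usual compositions; here for the tree's straight-line programs and explicit `GateList.plug`). Written
by the cdisprove seat of crux `stmt-PneNP-2143` (route `PneNP/SymmetryBudget`), where it is the
composition step of every upper-bound construction in the symmetry window. The idiom: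
if `σ` is an automorphism of the straight-line program `gs` extending the input map `π`
(`ListAut gs π σ`: gate `σ j` has the gate function of gate `j` and, as a multiset, the relabelled
argument wires of gate `j`), and the circuit `A` (inputs `κ`) has an automorphism `σA` extending
`πA`, and `A` is plugged behind `gs` along wires `ρ : κ → wires(gs)` that INTERTWINE the two actions
(`relabelWire π σ (ρ k) = ρ (πA k)`), then the block permutation `σ ⊕ σA` is an automorphism of the
plugged program extending `π` (`listAut_plug`), it acts on old wires as `σ` (`relabelWire_plug_old`)
and on the relocated wires of `A` as `σA` (`relabelWire_plug_shift`); in particular it fixes the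
plugged output (`relabelWire_plug_output`). Two instances drive everything downstream
(`SymmetricCompose.lean`): `ρ = Sum.inl`, `πA = π` (lay a symmetric circuit beside a symmetric
program) and `πA = id`, `σA = 1`, `ρ k` fixed by `σ` (post-compose a GENERAL circuit on
automorphism-fixed wires).
-/

namespace Literature.Computability.Complexity.GateList

open Literature.Computability.Complexity

/-! ### Block permutations of `ℕ` -/

section Block

variable {L n : ℕ} (σ₁ : Equiv.Perm (Fin L)) (σ₂ : Equiv.Perm (Fin n))

/-- The block sum `σ₁ ⊕ σ₂` as a total function on `ℕ`: `σ₁` on `[0, L)`, `σ₂` shifted on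
`[L, L + n)`, the identity beyond. [folklore] -/
def blockFun (j : ℕ) : ℕ :=
  if h : j < L then (σ₁ ⟨j, h⟩ : ℕ)
  else if h2 : j - L < n then L + (σ₂ ⟨j - L, h2⟩ : ℕ) else j

/-- `blockFun` on the first block. [folklore] -/
theorem blockFun_of_lt {j : ℕ} (h : j < L) : blockFun σ₁ σ₂ j = σ₁ ⟨j, h⟩ := by
  unfold blockFun; rw [dif_pos h]

/-- `blockFun` on the second block. [folklore] -/
theorem blockFun_mid (k : Fin n) : blockFun σ₁ σ₂ (L + k) = L + (σ₂ k : ℕ) := by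
  unfold blockFun
  rw [dif_neg (by omega), dif_pos (by rw [Nat.add_sub_cancel_left]; exact k.2)]
  congr 3
  exact Fin.ext (Nat.add_sub_cancel_left _ _)

/-- `blockFun` beyond both blocks. [folklore] -/
theorem blockFun_of_ge {j : ℕ} (h : L + n ≤ j) : blockFun σ₁ σ₂ j = j := by
  unfold blockFun; rw [dif_neg (by omega), dif_neg (by omega)]

/-- Trichotomy of positions. [folklore] -/
theorem block_cases (L n j : ℕ) : j < L ∨ (∃ k : Fin n, j = L + k) ∨ L + n ≤ j := by
  by_cases h : j < L
  · exact Or.inl h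
  · by_cases h2 : j - L < n
    · exact Or.inr (Or.inl ⟨⟨j - L, h2⟩, (Nat.add_sub_cancel' (Nat.not_lt.1 h)).symm⟩)
    · exact Or.inr (Or.inr (by omega))

/-- `blockFun σ₁⁻¹ σ₂⁻¹` inverts `blockFun σ₁ σ₂`. [folklore] -/
theorem blockFun_symm_blockFun (j : ℕ) :
    blockFun σ₁.symm σ₂.symm (blockFun σ₁ σ₂ j) = j := by
  rcases block_cases L n j with h | ⟨k, rfl⟩ | h
  · rw [blockFun_of_lt σ₁ σ₂ h, blockFun_of_lt σ₁.symm σ₂.symm (σ₁ ⟨j, h⟩).2, Fin.eta,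
      Equiv.symm_apply_apply]
  · rw [blockFun_mid, blockFun_mid, Equiv.symm_apply_apply]
  · rw [blockFun_of_ge σ₁ σ₂ h, blockFun_of_ge σ₁.symm σ₂.symm h]

/-- `blockFun` preserves every range containing both blocks. [folklore] -/
theorem blockFun_lt {M j : ℕ} (hM : L + n ≤ M) (hj : j < M) : blockFun σ₁ σ₂ j < M := by
  rcases block_cases L n j with h | ⟨k, rfl⟩ | h
  · rw [blockFun_of_lt σ₁ σ₂ h]; have := (σ₁ ⟨j, h⟩).2; omega
  · rw [blockFun_mid]; have := (σ₂ k).2; omega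
  · rw [blockFun_of_ge σ₁ σ₂ h]; exact hj

/-- The block sum `σ₁ ⊕ σ₂ ⊕ id` as a permutation of `Fin M`, `L + n ≤ M`. [folklore] -/
def blockPerm {M : ℕ} (hM : L + n ≤ M) : Equiv.Perm (Fin M) where
  toFun j := ⟨blockFun σ₁ σ₂ j, blockFun_lt σ₁ σ₂ hM j.2⟩
  invFun j := ⟨blockFun σ₁.symm σ₂.symm j, blockFun_lt σ₁.symm σ₂.symm hM j.2⟩
  left_inv j := Fin.ext (blockFun_symm_blockFun σ₁ σ₂ j)
  right_inv j := Fin.ext (by simpa using blockFun_symm_blockFun σ₁.symm σ₂.symm j)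

/-- The gate relabelling of the block permutation is `blockFun`. [folklore] -/
theorem relabelGate_blockPerm {M : ℕ} (hM : L + n ≤ M) (k : ℕ) :
    Circuit.relabelGate (blockPerm σ₁ σ₂ hM) k = blockFun σ₁ σ₂ k := by
  by_cases hk : k < M
  · rw [Circuit.relabelGate_of_lt _ hk]; rfl
  · rw [Circuit.relabelGate_of_le _ (Nat.not_lt.1 hk), blockFun_of_ge σ₁ σ₂ (by omega)]

end Block

/-! ### Automorphisms of gate lists -/

section Aut

variable {ι κ : Type*}

/-- `ListAut gs π σ`: the permutation `σ` of the positions of the straight-line program `gs` is an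
automorphism extending the input map `π` — gate `σ j` carries the gate function of gate `j` and its
argument wires are, as a multiset, the `(π, σ)`-relabelled argument wires of gate `j`. This is
`Circuit.IsInducedAut` without the output clause (`isInducedAut_iff_listAut`). [folklore] -/
structure ListAut (gs : List (Gate ι)) (π : ι → ι) (σ : Equiv.Perm (Fin gs.length)) : Prop where
  /-- gate `σ j` has the label of gate `j` and, as a multiset, its relabelled argument wires [folklore] -/
  out : ∀ j : Fin gs.length, (gs[σ j]).fn = (gs[j]).fn ∧
    (List.ofFn (gs[σ j]).args).Perm ((List.ofFn (gs[j]).args).map (Circuit.relabelWire π σ))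

/-- `IsInducedAut` = fixed output + `ListAut`. [folklore] -/
theorem isInducedAut_iff_listAut (C : Circuit ι) (π : ι → ι)
    (σ : Equiv.Perm (Fin C.gates.length)) :
    C.IsInducedAut π σ ↔ Circuit.relabelWire π σ C.output = C.output ∧ ListAut C.gates π σ :=
  ⟨fun h => ⟨h.1, ⟨h.2⟩⟩, fun h => ⟨h.1, h.2.out⟩⟩

/-- The identity is an automorphism of every program extending the identity. [folklore] -/
theorem listAut_one (gs : List (Gate ι)) : ListAut gs id 1 := by
  refine ⟨fun j => ⟨rfl, ?_⟩⟩
  have hF : ∀ w : ι ⊕ ℕ, Circuit.relabelWire (id : ι → ι) (1 : Equiv.Perm (Fin gs.length)) w = w := by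
    intro w
    cases w with
    | inl i => rfl
    | inr k =>
      rw [Circuit.relabelWire_inr]
      by_cases hk : k < gs.length
      · rw [Circuit.relabelGate_of_lt _ hk]; rfl
      · rw [Circuit.relabelGate_of_le _ (Nat.not_lt.1 hk)]
  rw [List.map_congr_left (fun w _ => hF w), List.map_id']
  exact List.Perm.refl _

variable (gs : List (Gate ι)) (ρ : κ → ι ⊕ ℕ) (A : Circuit κ)

/-- Positions of the plugged program: the total length. [folklore] -/
theorem le_length_plug : gs.length + A.gates.length ≤ (plug gs ρ A).1.length := by
  rw [length_plug]; rfl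

/-- A gate of the first block of a plug. [folklore] -/
theorem plug_getElem_left {k k₀ : ℕ} (he : k = k₀) (hk₀ : k₀ < gs.length)
    (hk : k < (plug gs ρ A).1.length) : (plug gs ρ A).1[k]'hk = gs[k₀] := by
  subst he
  exact List.getElem_append_left hk₀

/-- A gate of the second block of a plug is the relocated gate of `A`. [folklore] -/
theorem plug_getElem_right {k i : ℕ} (he : k = gs.length + i) (hi : i < A.gates.length)
    (hk : k < (plug gs ρ A).1.length) :
    (plug gs ρ A).1[k]'hk = reloc ρ gs.length (A.gates[i]) := by
  subst he
  show (gs ++ A.gates.map (reloc ρ gs.length))[gs.length + i]'(by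
    rw [List.length_append, List.length_map]; omega) = _
  rw [List.getElem_append_right (by omega)]
  simp only [List.getElem_map, Nat.add_sub_cancel_left]

/-- Transport of the argument-multiset condition through relocation: if `F` and `FA` commute
with the shift, a permutation statement for two gates of `A` becomes one for their relocations. [folklore] -/
theorem perm_reloc_of_perm {g₁ g₂ : Gate κ} {F : ι ⊕ ℕ → ι ⊕ ℕ} {FA : κ ⊕ ℕ → κ ⊕ ℕ} (L : ℕ)
    (hcomm : ∀ w, F (shiftWire ρ L w) = shiftWire ρ L (FA w))
    (hperm : (List.ofFn g₂.args).Perm ((List.ofFn g₁.args).map FA)) :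
    (List.ofFn (reloc ρ L g₂).args).Perm ((List.ofFn (reloc ρ L g₁).args).map F) := by
  have e1 : List.ofFn (reloc ρ L g₂).args = (List.ofFn g₂.args).map (shiftWire ρ L) := by
    rw [List.map_ofFn]; rfl
  have e2 : (List.ofFn (reloc ρ L g₁).args).map F =
      ((List.ofFn g₁.args).map FA).map (shiftWire ρ L) := by
    rw [List.map_map, List.map_ofFn, List.map_ofFn]
    exact congrArg List.ofFn (funext fun a => hcomm _)
  rw [e1, e2]
  exact hperm.map _

variable {gs ρ A}
variable {π : ι → ι} {σ : Equiv.Perm (Fin gs.length)} {πA : κ → κ}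
  {σA : Equiv.Perm (Fin A.gates.length)}

/-- The automorphism of a plug: `σ` on the old block, `σA` on the block of `A`. [folklore] -/
def plugPerm (σ : Equiv.Perm (Fin gs.length)) (σA : Equiv.Perm (Fin A.gates.length)) :
    Equiv.Perm (Fin (plug gs ρ A).1.length) :=
  blockPerm σ σA (le_length_plug gs ρ A)

/-- **Old wires**: on wires of `gs` the plug automorphism acts as `σ`. [folklore] -/
theorem relabelWire_plug_old {w : ι ⊕ ℕ} (hw : OutOK gs.length w) :
    Circuit.relabelWire π (plugPerm (ρ := ρ) σ σA) w = Circuit.relabelWire π σ w := by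
  cases w with
  | inl i => rfl
  | inr k =>
    have hk : k < gs.length := hw k rfl
    rw [Circuit.relabelWire_inr, Circuit.relabelWire_inr, plugPerm, relabelGate_blockPerm,
      blockFun_of_lt σ σA hk, Circuit.relabelGate_of_lt σ hk]

/-- **New wires**: on the relocated wires of `A` the plug automorphism acts as `σA`, provided the
feeding wires intertwine the two actions. [folklore] -/
theorem relabelWire_plug_shift (hρ : ∀ k, Circuit.relabelWire π σ (ρ k) = ρ (πA k))
    (hρOK : WiresOK gs.length ρ) (w : κ ⊕ ℕ) :
    Circuit.relabelWire π (plugPerm (ρ := ρ) σ σA) (shiftWire ρ gs.length w) =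
      shiftWire ρ gs.length (Circuit.relabelWire πA σA w) := by
  cases w with
  | inl k =>
    show Circuit.relabelWire π (plugPerm σ σA) (ρ k) = shiftWire ρ gs.length (Sum.inl (πA k))
    rw [relabelWire_plug_old (fun m hm => hρOK k m hm), hρ k]
    rfl
  | inr j =>
    show Sum.inr (Circuit.relabelGate (plugPerm (ρ := ρ) σ σA) (j + gs.length)) =
      shiftWire ρ gs.length (Sum.inr (Circuit.relabelGate σA j))
    rw [plugPerm, relabelGate_blockPerm]
    by_cases hj : j < A.gates.length
    · rw [Nat.add_comm, show gs.length + j = gs.length + ((⟨j, hj⟩ : Fin _) : ℕ) from rfl,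
        blockFun_mid, Circuit.relabelGate_of_lt σA hj]
      show Sum.inr _ = Sum.inr ((σA ⟨j, hj⟩ : ℕ) + gs.length)
      rw [Nat.add_comm]
    · rw [blockFun_of_ge σ σA (by omega), Circuit.relabelGate_of_le σA (Nat.not_lt.1 hj)]
      rfl

/-- **Induced automorphisms are closed under plugging.** If `σ` is an automorphism of the
well-formed program `gs` extending `π`, `σA` one of the circuit `A` extending `πA`, and the feeding
wires `ρ` are valid and intertwine (`relabelWire π σ (ρ k) = ρ (πA k)`), then `σ ⊕ σA` is an
automorphism of `plug gs ρ A` extending `π`. [folklore; Anderson–Dawar 2017 §2] [folklore] -/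
theorem listAut_plug (hwf : WF gs) (hgs : ListAut gs π σ) (hA : A.IsInducedAut πA σA)
    (hρ : ∀ k, Circuit.relabelWire π σ (ρ k) = ρ (πA k)) (hρOK : WiresOK gs.length ρ) :
    ListAut (plug gs ρ A).1 π (plugPerm (ρ := ρ) σ σA) := by
  refine ⟨fun j => ?_⟩
  have hjM : (j : ℕ) < (plug gs ρ A).1.length := j.2
  have hσj : ((plugPerm (ρ := ρ) σ σA j : Fin _) : ℕ) = blockFun σ σA j := rfl
  rw [Fin.getElem_fin, Fin.getElem_fin]
  rcases block_cases gs.length A.gates.length j with h | ⟨i, hi⟩ | h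
  · -- old block
    have h1 : blockFun σ σA j = (σ ⟨j, h⟩ : ℕ) := blockFun_of_lt σ σA h
    rw [plug_getElem_left gs ρ A (hσj.trans h1) (σ ⟨j, h⟩).2,
      plug_getElem_left gs ρ A rfl h]
    obtain ⟨hfn, hperm⟩ := hgs.out ⟨j, h⟩
    rw [Fin.getElem_fin, Fin.getElem_fin] at hfn hperm
    refine ⟨hfn, ?_⟩
    -- the two relabellings agree on the arguments of an old gate (well-formedness)
    have hmap : (List.ofFn (gs[(j : ℕ)]).args).map (Circuit.relabelWire π (plugPerm (ρ := ρ) σ σA)) =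
        (List.ofFn (gs[(j : ℕ)]).args).map (Circuit.relabelWire π σ) :=
      List.map_congr_left fun w hw => by
        obtain ⟨a, rfl⟩ := List.mem_ofFn.1 hw
        exact relabelWire_plug_old fun m hm =>
          (hwf j _ (List.getElem?_eq_getElem h) a m hm).trans h
    rw [hmap]
    exact hperm
  · -- block of `A`
    have hiA : (i : ℕ) < A.gates.length := i.2
    have h1 : blockFun σ σA j = gs.length + (σA i : ℕ) := by rw [hi, blockFun_mid]
    rw [plug_getElem_right gs ρ A (hσj.trans h1) (σA i).2, plug_getElem_right gs ρ A hi hiA]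
    obtain ⟨hfn, hperm⟩ := hA.2 i
    rw [Fin.getElem_fin, Fin.getElem_fin] at hfn hperm
    refine ⟨by rw [reloc_fn, reloc_fn]; exact hfn, ?_⟩
    exact perm_reloc_of_perm ρ gs.length (fun w => relabelWire_plug_shift hρ hρOK w) hperm
  · have hlen := length_plug gs ρ A
    have hsz : A.size = A.gates.length := rfl
    omega

/-- The plugged output wire is fixed by the plug automorphism. [folklore] -/
theorem relabelWire_plug_output (hA : A.IsInducedAut πA σA)
    (hρ : ∀ k, Circuit.relabelWire π σ (ρ k) = ρ (πA k)) (hρOK : WiresOK gs.length ρ) :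
    Circuit.relabelWire π (plugPerm (ρ := ρ) σ σA) (plug gs ρ A).2 = (plug gs ρ A).2 := by
  show Circuit.relabelWire π (plugPerm σ σA) (shiftWire ρ gs.length A.output) = _
  rw [relabelWire_plug_shift hρ hρOK, hA.1]
  rfl

end Aut

/-- The output wire of a plug along valid wires is valid. [folklore] -/
theorem outOK_plug_snd {ι κ : Type*} {gs : List (Gate ι)} {ρ : κ → ι ⊕ ℕ} {A : Circuit κ}
    (hρ : WiresOK gs.length ρ) : OutOK (plug gs ρ A).1.length (plug gs ρ A).2 := by
  intro k hk
  rw [length_plug]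
  change shiftWire ρ gs.length A.output = Sum.inr k at hk
  cases hout : A.output with
  | inl i =>
    rw [hout] at hk
    exact (hρ i k hk).trans_le (Nat.le_add_right _ _)
  | inr k' =>
    rw [hout] at hk
    simp only [shiftWire, Sum.inr.injEq] at hk
    have := A.wf_output k' hout
    simp only [Circuit.size]
    omega

end Literature.Computability.Complexity.GateList
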